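import Literature.NumberTheory.ComplexMultiplication.EllipticUnits.ImaginaryQuadraticMainConjectureCarriersO
import Literature.NumberTheory.ComplexMultiplication.EllipticUnits.ImaginaryQuadraticMainConjectureCarriersLevels
import HarnessLib

/-!
# Toward the EXISTENCE of the pinned `𝒪`-coefficient carriers
# `H^i(𝒪_K[1/p𝔣], Λ_𝒪(χ)(1)) = lim←_{n,k} H^i(G_S(K̃_n), 𝒪 ⊗ μ_{p^k} ⊗ θ)` of Johnson-Leung–Kings 2011 Def. 4.2 (94) /
# Cor. 5.3 with their `Λ_𝒪 = 𝒪⟦Gal(K_∞/K)⟧`-structure (`JohnsonLeungKings2011.IwasawaCohomologyDataO`) — part I: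
# the LEVEL structure (uniform torsion, the conjugation operators, the `𝒪`-ACTION `c ↦ H^i(c ⊗ id)` as a ring action,
# local nilpotence, equivariance of the reductions)

Topic `Literature/NumberTheory/ComplexMultiplication/EllipticUnits` (grouping sub-namespace `JohnsonLeungKings2011`);
companion of `ImaginaryQuadraticMainConjectureCarriersO.lean` (INPUTS hand `bsd-inputs-honda-p1` g22, crux L
`SmallImageLowerHalfBothSigns` line `rtt_w3`, row D2-O), whose review (p776397) noted «a construction item should follow
as for the ℤ_p twin»; this is the `𝒪`-coefficient twin of `ImaginaryQuadraticMainConjectureCarriersLevels.lean`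
(cf2-p1-w5's construction F0a for `ℤ_p`). THEOREMS and transparent definitions only (the ring homomorphism
`levelScalarRingHomO`, the `letI`-recipe `levelModuleO`, the `𝒪`-linear operators `layerPsiO`); no named fact,
no `instance`, no `sorry`.

THE CONSTRUCTION (Kato §8.2 "`H^q(R,T) = lim←_n H^q(R, T/p^n)`"; JLK Def. 4.1 "`Λ_𝒪 := Λ ⊗̂_{ℤ_p} 𝒪_p`", Def. 4.2 (94)
with "the (left) `Λ_𝒪`-module structure"; Lang, *Cyclotomic Fields* Ch. 5 §1): on the level `(n, k)` the conjugation
operators `conj_{γ₁}, conj_{γ₂}` (`layerConjO`, the tree's `conjMap`) COMMUTE (their commutator is conjugation by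
`[γ₁, γ₂] ∈ Gal(K̄/K̃_n)`, an inner automorphism), are UNIPOTENT of echelon `pⁿ` (`γ^{pⁿ} ∈ Gal(K̄/K̃_n)`) and the
level is killed by `p^k` UNIFORMLY (`𝒪 ⊗ μ_{p^k}` is), so `(conj_{γ₁} − 1, conj_{γ₂} − 1)` is `IsLocNil₂`; NEW for
`𝒪`-coefficients: the coefficient multiplications `H^i(c ⊗ id)` (`levelScalarO` of the companion file) form a RING ACTION
`𝒪 → End` (`levelScalarRingHomO`; additivity = additivity of Mathlib's `ContinuousCohomology.map` in the coefficient
morphism, §0, via `HomologicalComplex.homologyMap_add`; multiplicativity / unit = the tree's pointwise functoriality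
`map_comp_apply_of` / `continuousCohomology_map_eq_id`), commuting with the conjugations (`cohomologyMap_conjMap`) and
with the reductions (`map_comp_apply_of`), so `ψ_{γ_i} := conj_{γ_i} − 1` are commuting locally nilpotent `𝒪`-LINEAR
operators (`layerPsiO`, `layerPsiO_comm_and_locallyNilpotent`) — the input of the tree's
`LocallyNilpotent.exists_module_powerSeries₂` (`𝒪⟦T₂⟧⟦T₁⟧`-structure, part II). NO hypothesis on `K`, `(γ₁, γ₂)`,
`θ`, `𝔣`.

* §0 `continuousCohomology_map_add/_zero/_comp` — additivity of `ContinuousCohomology.map` along the identity of the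
  group in the coefficient morphism (generic; Mathlib has `map_id`/`map_comp` only).
* §1 `OMuCarrier.pow_smul_eq_zero`, `coeffGSO_torsion`, `levelCohO_torsion` (uniform `p^k`-torsion).
* §2 `levelConjO_one/_levelConjO`, `conjEndO_pow_apply`, `levelConjO_eq_self_of_mem` (`i ≤ 2`).
* §3 `oMuScalar_add/_mul/_one`, `levelMapHomO_add/_comp`, `levelScalarO_add/_mul/_one`, `levelScalarRingHomO`,
  `levelModuleO` (+ `_smul`).
* §4 `levelMapHomO_levelConjO`, `levelRedO_levelConjO`, `levelScalarO_levelConjO`, `levelRedO_levelScalarO`.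
* §5 layers: `layerConjEndO_pow_apply_eq_self`, `commute_layerConjEndO`, `isLocNil₂_layerConjEndO`, `layerPsiO`
  (+ `_apply`, `_comm_and_locallyNilpotent`), `layerRedO_layerConjO`, `layerRedO_layerScalarO`.
* (part II, `…CarriersOExist.lean`) the corestrictions (`relCor_conjMap`, `relCor_cohomologyMap`), the
  `Λ_𝒪`-submodule of compatible families, `Nonempty (IwasawaCohomologyDataO …)`.

## References
* [JohnsonLeungKings2011] J. reine angew. Math. 653 (2011) = arXiv:0804.2828, §4.1 Def. 4.1 (p0012:L59–60), §4.2 Def. 4.2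
  (94) and the `Λ_𝒪`-module structure (p0012:L80–112); Cor. 5.3 (p0015:L1–20).
* [Kato2004Asterisque] K. Kato, Astérisque 295 (2004), §8.2 (p. 180), §12.2 (12.2.1) (p. 220).
* [Lang1990] S. Lang, *Cyclotomic Fields I and II*, Ch. 5 §1 (Thm. 1.1).
* [SerreLocalFields1979] VII §5 Prop. 3 (inner automorphisms act trivially); [NeukirchSchmidtWingberg2008] I §5 Prop. 1.5.4.
-/

noncomputable section

open scoped NumberField TensorProduct
open CategoryTheory Field IsDedekindDomain
open Literature.NumberTheory.GaloisRepresentations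
open Literature.NumberTheory.GaloisRepresentations.DiscreteGaloisModule
open Literature.NumberTheory.EllipticCurves Literature.NumberTheory.EllipticCurves.IwasawaDual

namespace Literature.NumberTheory.ComplexMultiplication.EllipticUnits.JohnsonLeungKings2011

/-! ## §0 Additivity of Mathlib's continuous-cohomology functoriality in the coefficient morphism -/

section Additive

universe u
variable {k : Type u} [CommRing k] [TopologicalSpace k]
  {G : Type u} [Group G] [TopologicalSpace G] [IsTopologicalGroup G]
  {X Y : TopRep.{u} k G}

/-- `resolutionMap id` is additive in the coefficient morphism. [folklore] -/
private theorem resolutionMap_add (f g : X ⟶ Y) (i : ℕ) :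
    ContinuousCohomology.resolutionMap (ContinuousMonoidHom.id G) (f + g) i =
      ContinuousCohomology.resolutionMap (ContinuousMonoidHom.id G) f i +
        ContinuousCohomology.resolutionMap (ContinuousMonoidHom.id G) g i := by
  induction i with
  | zero => rfl
  | succ i ih =>
    rw [ContinuousCohomology.resolutionMap_succ, ContinuousCohomology.resolutionMap_succ,
      ContinuousCohomology.resolutionMap_succ, ih]
    ext F x
    rfl

/-- `cochainsMap id` is additive in the coefficient morphism. [folklore] -/
private theorem cochainsMap_add (f g : X ⟶ Y) :
    ContinuousCohomology.cochainsMap (ContinuousMonoidHom.id G) (f + g) =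
      ContinuousCohomology.cochainsMap (ContinuousMonoidHom.id G) f +
        ContinuousCohomology.cochainsMap (ContinuousMonoidHom.id G) g := by
  ext i : 1
  rw [HomologicalComplex.add_f_apply, ContinuousCohomology.cochainsMap_f, ContinuousCohomology.cochainsMap_f,
    ContinuousCohomology.cochainsMap_f, resolutionMap_add]
  ext v x
  rfl

/-- **`H^i(f + g) = H^i(f) + H^i(g)`** for morphisms of coefficients (Mathlib's `ContinuousCohomology.map` along
the identity of the group is additive: cohomology is an additive functor of the coefficient module).
[cite: SerreGaloisCohomology1997, I §2.2 (functoriality of `H^q(G, A)` in the `G`-module `A`)] -/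
theorem continuousCohomology_map_add (f g : X ⟶ Y) (i : ℕ) :
    ContinuousCohomology.map (ContinuousMonoidHom.id G) (f + g) i =
      ContinuousCohomology.map (ContinuousMonoidHom.id G) f i + ContinuousCohomology.map (ContinuousMonoidHom.id G) g i := by
  rw [ContinuousCohomology.map, ContinuousCohomology.map, ContinuousCohomology.map, cochainsMap_add,
    HomologicalComplex.homologyMap_add]

/-- `H^i(0) = 0` (additivity of cohomology in the coefficients). [cite: SerreGaloisCohomology1997, I §2.2] -/
theorem continuousCohomology_map_zero (i : ℕ) :
    ContinuousCohomology.map (ContinuousMonoidHom.id G) (X := X) (Y := Y) (0 : X ⟶ Y) i = 0 := by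
  have h := continuousCohomology_map_add (0 : X ⟶ Y) 0 i
  rw [add_zero] at h
  exact left_eq_add.mp h

/-- `H^i(f ≫ g) = H^i(f) ≫ H^i(g)` along the identity of the group (functoriality in the coefficients).
[cite: SerreGaloisCohomology1997, I §2.2] -/
theorem continuousCohomology_map_comp {Z : TopRep.{u} k G} (f : X ⟶ Y) (g : Y ⟶ Z) (i : ℕ) :
    ContinuousCohomology.map (ContinuousMonoidHom.id G) (X := X) (Y := Z) (f ≫ g) i =
      ContinuousCohomology.map (ContinuousMonoidHom.id G) (X := X) (Y := Y) f i ≫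
        ContinuousCohomology.map (ContinuousMonoidHom.id G) (X := Y) (Y := Z) g i := by
  exact ContinuousCohomology.map_comp (ContinuousMonoidHom.id G) (ContinuousMonoidHom.id G) f g i

end Additive

/-! ## §1 Uniform `p^k`-torsion of the level groups -/

section Level

variable {K : Type} [Field K] [NumberField K] {p : ℕ} [Fact p.Prime] (S : Set (PadicAlgCl p))
  (P : Set (HeightOneSpectrum (𝓞 K))) (θ : absoluteGaloisGroup K →ₜ* (padicCoeffIntegers S)ˣ)

omit [NumberField K] [Fact p.Prime] in
/-- `p^k` kills `μ_{p^k}`. [folklore] -/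
private theorem pow_smul_muCarrier' (k : ℕ) (v : MuCarrier K (p ^ k)) : ((p : ℤ) ^ k) • v = 0 := by
  have h : ((p : ℤ) ^ k) • v = (p ^ k : ℕ) • v := by rw [← natCast_zsmul, Nat.cast_pow]
  rw [h]
  apply muVal_injective K (p ^ k)
  rw [muVal_nsmul, muVal_pow_eq_one, muVal_zero]

omit [NumberField K] in
/-- **`𝒪 ⊗ μ_{p^k}` is killed by `p^k`** (`p^k (a ⊗ ζ) = a ⊗ p^k ζ = 0`). [folklore: plumbing]
[cite: JohnsonLeungKings2011, Def. 4.2 (arXiv p0012:L80–95)] -/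
theorem OMuCarrier.pow_smul_eq_zero (k : ℕ) (x : OMuCarrier K S (p ^ k)) : ((p : ℤ) ^ k) • x = 0 := by
  induction x using OMuCarrier.induction_on with
  | zero => rw [smul_zero]
  | tmul a v =>
    change OMuCarrier.toTensor.symm (((p : ℤ) ^ k) • (a ⊗ₜ v)) = OMuCarrier.toTensor.symm 0
    rw [TensorProduct.smul_tmul', TensorProduct.smul_tmul, pow_smul_muCarrier', TensorProduct.tmul_zero]
  | add x y hx hy => rw [smul_add, hx, hy, add_zero]

omit [NumberField K] in
/-- **The coefficients `(𝒪 ⊗ μ_{p^k} ⊗ θ)^{N_S}` are killed by `p^k`.** [cite: JohnsonLeungKings2011, Def. 4.2 (arXiv p0012:L80–95)] -/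
theorem coeffGSO_torsion (k : ℕ) (w : (coeffGSO S P θ k).toTopRep) : (p ^ k : ℤ) • w = 0 := by
  apply Subtype.ext
  rw [Submodule.coe_smul, Submodule.coe_zero]
  exact OMuCarrier.pow_smul_eq_zero S k _

/-- **UNIFORM `p^k`-torsion of the level groups**: every class of `H^i(G_S(F), 𝒪 ⊗ μ_{p^k} ⊗ θ)` is killed by
`p^k` (the tree's `continuousCohomology_exists_forall_smul_eq_zero` with the constant family `J ≡ (p^k)`).
[cite: Kato2004Asterisque, §8.2 (p. 180)] [cite: Lang1990, Ch. 5 §1] -/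
theorem levelCohO_torsion {U : Subgroup (absoluteGaloisGroup K)} (hU : IsOpen (U : Set (absoluteGaloisGroup K)))
    (k i : ℕ) (x : levelCohO S P θ U k i) : p ^ k • x = 0 := by
  haveI : CompactSpace (imGS P U) := isCompact_iff_compactSpace.mp (isClosed_imGS' P hU).isCompact
  obtain ⟨m, hm⟩ := continuousCohomology_exists_forall_smul_eq_zero (levelRepO S P θ U k).toTopRep
    (fun _ ↦ Ideal.span {((p ^ k : ℕ) : ℤ)})
    (fun C _ ↦ ⟨0, fun r hr w _ ↦ by
      obtain ⟨c, rfl⟩ := Ideal.mem_span_singleton'.mp hr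
      rw [mul_comm, mul_smul, Nat.cast_pow, coeffGSO_torsion]⟩) i x
  have h := hm ((p ^ k : ℕ) : ℤ) (Ideal.mem_span_singleton_self _)
  rwa [Nat.cast_smul_eq_nsmul] at h

/-! ## §2 The conjugation operators: unit, composition, powers, triviality on `U` -/

variable {U : Subgroup (absoluteGaloisGroup K)} [U.Normal]

/-- The conjugation operator of `γ` on a level group, as an element of `AddMonoid.End`.
[cite: JohnsonLeungKings2011, §4.2 (arXiv p0012:L109–112)] -/
abbrev conjEndO (U : Subgroup (absoluteGaloisGroup K)) [U.Normal] (k i : ℕ) (γ : absoluteGaloisGroup K) :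
    AddMonoid.End (levelCohO S P θ U k i) :=
  levelConjO S P θ U k i γ

omit [NumberField K] in
/-- Unfolding `conjEndO`. [cite: JohnsonLeungKings2011, §4.2 (arXiv p0012:L109–112)] -/
theorem conjEndO_apply (k i : ℕ) (γ : absoluteGaloisGroup K) (c : levelCohO S P θ U k i) :
    conjEndO S P θ U k i γ c = levelConjO S P θ U k i γ c := rfl

omit [NumberField K] in
/-- **`1 ∈ Γ_K` acts trivially** on the levels. [cite: SerreLocalFields1979, VII §5] -/
theorem levelConjO_one (k i : ℕ) (c : levelCohO S P θ U k i) : levelConjO S P θ U k i 1 c = c := by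
  haveI := normal_imGS P U
  rw [levelConjO_apply]
  have h : conjMap (coeffGSO S P θ k).toTopRep (imGS P U) (toUnramifiedQuot K P 1) i = 𝟙 _ := by
    rw [map_one, conjMap]
    exact continuousCohomology_map_eq_id _ _ (subgroupConj_one _)
      (fun v ↦ by
        change (coeffGSO S P θ k).toTopRep.ρ 1 v = v
        rw [map_one]; rfl) i
  rw [h]; rfl

omit [NumberField K] in
/-- **`(γ ·) ∘ (γ' ·) = (γγ' ·)`** on the levels. [cite: SerreLocalFields1979, VII §5] -/
theorem levelConjO_levelConjO (k i : ℕ) (γ γ' : absoluteGaloisGroup K) (c : levelCohO S P θ U k i) :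
    levelConjO S P θ U k i γ (levelConjO S P θ U k i γ' c) = levelConjO S P θ U k i (γ * γ') c := by
  haveI := normal_imGS P U
  rw [levelConjO_apply, levelConjO_apply, levelConjO_apply, conjMap_conjMap, ← map_mul]

omit [NumberField K] in
/-- **Powers of the conjugation operator**: `(γ ·)^m = (γ^m ·)`. [cite: SerreLocalFields1979, VII §5] -/
theorem conjEndO_pow_apply (k i : ℕ) (γ : absoluteGaloisGroup K) (m : ℕ) (c : levelCohO S P θ U k i) :
    (conjEndO S P θ U k i γ ^ m) c = levelConjO S P θ U k i (γ ^ m) c := by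
  induction m generalizing c with
  | zero => rw [pow_zero, pow_zero, AddMonoid.End.one_apply, levelConjO_one]
  | succ m ih =>
    rw [pow_succ, AddMonoid.End.coe_mul, Function.comp_apply, conjEndO_apply, ih, levelConjO_levelConjO,
      ← pow_succ]

/-- **Elements of `U` act trivially on `H^i(G_S(F), ·)`, `i = 0, 1, 2`** (inner automorphisms).
[cite: SerreLocalFields1979, VII §5 Prop. 3] -/
theorem levelConjO_eq_self_of_mem {γ : absoluteGaloisGroup K} (hγ : γ ∈ U)
    (hU : IsOpen (U : Set (absoluteGaloisGroup K))) (k : ℕ) {i : ℕ} (hi : i ≤ 2)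
    (c : levelCohO S P θ U k i) : levelConjO S P θ U k i γ c = c := by
  haveI := normal_imGS P U
  haveI : LocallyCompactSpace (imGS P U) := (isClosed_imGS' P hU).locallyCompactSpace
  have hmem : toUnramifiedQuot K P γ ∈ imGS P U := Subgroup.mem_map_of_mem _ hγ
  rw [levelConjO_apply]
  obtain rfl | rfl | rfl : i = 0 ∨ i = 1 ∨ i = 2 := by omega
  · exact conjMap_eq_self_of_mem_zero (coeffGSO S P θ k).toTopRep (imGS P U) hmem c
  · exact conjMap_eq_self_of_mem_one (coeffGSO S P θ k).toTopRep (imGS P U) hmem c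
  · exact conjMap_eq_self_of_mem_two (coeffGSO S P θ k).toTopRep (imGS P U) hmem c

/-! ## §3 The `𝒪`-structure of the level groups: `c ↦ H^i(c ⊗ id)` is a ring action -/

omit [NumberField K] in
/-- `OMuCarrier.tmul` is additive in the first variable. [folklore: plumbing]
[cite: JohnsonLeungKings2011, Def. 4.2 (arXiv p0012:L80–90)] -/
theorem OMuCarrier.add_tmul {n : ℕ} (a b : padicCoeffIntegers S) (v : MuCarrier K n) :
    OMuCarrier.tmul (a + b) v = OMuCarrier.tmul a v + OMuCarrier.tmul b v := by
  change OMuCarrier.toTensor.symm ((a + b) ⊗ₜ v) = OMuCarrier.toTensor.symm (a ⊗ₜ v) + OMuCarrier.toTensor.symm (b ⊗ₜ v)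
  rw [TensorProduct.add_tmul, map_add]

omit [NumberField K] in
/-- `(c + c') ⊗ id = c ⊗ id + c' ⊗ id`. [cite: JohnsonLeungKings2011, §4.2 (arXiv p0012:L72–76)] -/
theorem oMuScalar_add (n : ℕ) (c c' : padicCoeffIntegers S) (x : OMuCarrier K S n) :
    oMuScalar S n (c + c') x = oMuScalar S n c x + oMuScalar S n c' x := by
  induction x using OMuCarrier.induction_on with
  | zero => simp
  | tmul a v => rw [oMuScalar_tmul, oMuScalar_tmul, oMuScalar_tmul, add_mul, OMuCarrier.add_tmul]
  | add x y hx hy => rw [map_add, map_add, map_add, hx, hy]; abel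

omit [NumberField K] in
/-- `(c c') ⊗ id = (c ⊗ id) ∘ (c' ⊗ id)`. [cite: JohnsonLeungKings2011, §4.2 (arXiv p0012:L72–76)] -/
theorem oMuScalar_mul (n : ℕ) (c c' : padicCoeffIntegers S) (x : OMuCarrier K S n) :
    oMuScalar S n (c * c') x = oMuScalar S n c (oMuScalar S n c' x) := by
  induction x using OMuCarrier.induction_on with
  | zero => simp
  | tmul a v => rw [oMuScalar_tmul, oMuScalar_tmul, oMuScalar_tmul, mul_assoc]
  | add x y hx hy => rw [map_add, map_add, map_add, hx, hy]

omit [NumberField K] in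
/-- `1 ⊗ id = id`. [cite: JohnsonLeungKings2011, §4.2 (arXiv p0012:L72–76)] -/
theorem oMuScalar_one (n : ℕ) (x : OMuCarrier K S n) : oMuScalar S n 1 x = x := by
  induction x using OMuCarrier.induction_on with
  | zero => simp
  | tmul a v => rw [oMuScalar_tmul, one_mul]
  | add x y hx hy => rw [map_add, hx, hy]

omit [NumberField K] in
/-- `levelMapHomO` of a sum of coefficient maps is the sum. [folklore: plumbing]
[cite: JohnsonLeungKings2011, Def. 4.2 (arXiv p0012:L80–95)] -/
theorem levelMapHomO_add (U : Subgroup (absoluteGaloisGroup K)) {k k' : ℕ}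
    (f g : OMuCarrier K S (p ^ k) →+ OMuCarrier K S (p ^ k'))
    (hf : ∀ (σ : absoluteGaloisGroup K) (x : OMuCarrier K S (p ^ k)), f (muTwistO S θ k σ x) = muTwistO S θ k' σ (f x))
    (hg : ∀ (σ : absoluteGaloisGroup K) (x : OMuCarrier K S (p ^ k)), g (muTwistO S θ k σ x) = muTwistO S θ k' σ (g x))
    (hfg : ∀ (σ : absoluteGaloisGroup K) (x : OMuCarrier K S (p ^ k)), (f + g) (muTwistO S θ k σ x) = muTwistO S θ k' σ ((f + g) x)) :
    levelMapHomO S P θ U (f + g) hfg = levelMapHomO S P θ U f hf + levelMapHomO S P θ U g hg := by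
  ext w
  rfl

omit [NumberField K] in
/-- `levelMapHomO` of a composite of coefficient maps is the composite. [folklore: plumbing]
[cite: JohnsonLeungKings2011, Def. 4.2 (arXiv p0012:L80–95)] -/
theorem levelMapHomO_comp (U : Subgroup (absoluteGaloisGroup K)) {k k' k'' : ℕ}
    (f : OMuCarrier K S (p ^ k) →+ OMuCarrier K S (p ^ k')) (g : OMuCarrier K S (p ^ k') →+ OMuCarrier K S (p ^ k''))
    (hf : ∀ (σ : absoluteGaloisGroup K) (x : OMuCarrier K S (p ^ k)), f (muTwistO S θ k σ x) = muTwistO S θ k' σ (f x))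
    (hg : ∀ (σ : absoluteGaloisGroup K) (x : OMuCarrier K S (p ^ k')), g (muTwistO S θ k' σ x) = muTwistO S θ k'' σ (g x))
    (hgf : ∀ (σ : absoluteGaloisGroup K) (x : OMuCarrier K S (p ^ k)), (g.comp f) (muTwistO S θ k σ x) = muTwistO S θ k'' σ ((g.comp f) x)) :
    levelMapHomO S P θ U (g.comp f) hgf = levelMapHomO S P θ U f hf ≫ levelMapHomO S P θ U g hg := by
  ext w
  rfl

omit [NumberField K] in
/-- **Additivity of the coefficient multiplication**: `H^i((c + c') ⊗ id) = H^i(c ⊗ id) + H^i(c' ⊗ id)`.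
[cite: JohnsonLeungKings2011, §4.1 Def. 4.1 (Λ_𝒪 = Λ ⊗̂ 𝒪_p, arXiv p0012:L59–60)] -/
theorem levelScalarO_add (U : Subgroup (absoluteGaloisGroup K)) (k i : ℕ) (c c' : padicCoeffIntegers S) :
    levelScalarO S P θ U k i (c + c') = levelScalarO S P θ U k i c + levelScalarO S P θ U k i c' := by
  have h : levelMapHomO S P θ U (oMuScalar S (p ^ k) (c + c')) (oMuScalar_muTwistO S θ k (c + c')) =
      levelMapHomO S P θ U (oMuScalar S (p ^ k) c) (oMuScalar_muTwistO S θ k c) +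
        levelMapHomO S P θ U (oMuScalar S (p ^ k) c') (oMuScalar_muTwistO S θ k c') := by
    ext w
    exact congrArg Subtype.val (Subtype.ext (oMuScalar_add S (p ^ k) c c' (w : OMuCarrier K S (p ^ k))) :
      coeffMapO S P θ (oMuScalar S (p ^ k) (c + c')) (oMuScalar_muTwistO S θ k (c + c')) w =
        coeffMapO S P θ (oMuScalar S (p ^ k) c) (oMuScalar_muTwistO S θ k c) w +
          coeffMapO S P θ (oMuScalar S (p ^ k) c') (oMuScalar_muTwistO S θ k c') w)
  apply AddMonoidHom.ext
  intro x
  have e := continuousCohomology_map_add (levelMapHomO S P θ U (oMuScalar S (p ^ k) c) (oMuScalar_muTwistO S θ k c))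
    (levelMapHomO S P θ U (oMuScalar S (p ^ k) c') (oMuScalar_muTwistO S θ k c')) i
  rw [AddMonoidHom.add_apply, levelScalarO_apply, levelScalarO_apply, levelScalarO_apply, h]
  exact congrArg (fun m ↦ (TopModuleCat.Hom.hom m) x) e

omit [NumberField K] in
/-- **Multiplicativity**: `H^i((c c') ⊗ id) = H^i(c ⊗ id) ∘ H^i(c' ⊗ id)`.
[cite: JohnsonLeungKings2011, §4.1 Def. 4.1 (arXiv p0012:L59–60)] -/
theorem levelScalarO_mul (U : Subgroup (absoluteGaloisGroup K)) (k i : ℕ) (c c' : padicCoeffIntegers S)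
    (x : levelCohO S P θ U k i) :
    levelScalarO S P θ U k i (c * c') x = levelScalarO S P θ U k i c (levelScalarO S P θ U k i c' x) := by
  rw [levelScalarO_apply, levelScalarO_apply, levelScalarO_apply]
  have h := map_comp_apply_of (ContinuousMonoidHom.id (imGS P U)) (ContinuousMonoidHom.id (imGS P U))
    (ContinuousMonoidHom.id (imGS P U))
    (fun _ ↦ rfl) (levelMapHomO S P θ U (oMuScalar S (p ^ k) c') (oMuScalar_muTwistO S θ k c'))
    (levelMapHomO S P θ U (oMuScalar S (p ^ k) c) (oMuScalar_muTwistO S θ k c))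
    (levelMapHomO S P θ U (oMuScalar S (p ^ k) (c * c')) (oMuScalar_muTwistO S θ k (c * c')))
    (fun w ↦ Subtype.ext (oMuScalar_mul S (p ^ k) c c' (w : OMuCarrier K S (p ^ k))) :
      ∀ w : (levelRepO S P θ U k).toTopRep,
        coeffMapO S P θ (oMuScalar S (p ^ k) (c * c')) (oMuScalar_muTwistO S θ k (c * c')) w =
          coeffMapO S P θ (oMuScalar S (p ^ k) c) (oMuScalar_muTwistO S θ k c)
            (coeffMapO S P θ (oMuScalar S (p ^ k) c') (oMuScalar_muTwistO S θ k c') w)) i x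
  exact h

omit [NumberField K] in
/-- **Unit**: `H^i(1 ⊗ id) = id`. [cite: JohnsonLeungKings2011, §4.1 Def. 4.1 (arXiv p0012:L59–60)] -/
theorem levelScalarO_one (U : Subgroup (absoluteGaloisGroup K)) (k i : ℕ) (x : levelCohO S P θ U k i) :
    levelScalarO S P θ U k i 1 x = x := by
  have h : ContinuousCohomology.map (ContinuousMonoidHom.id (imGS P U)) (X := (levelRepO S P θ U k).toTopRep)
      (Y := (levelRepO S P θ U k).toTopRep)
      (levelMapHomO S P θ U (oMuScalar S (p ^ k) 1) (oMuScalar_muTwistO S θ k 1)) i = 𝟙 _ :=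
    continuousCohomology_map_eq_id (X := (levelRepO S P θ U k).toTopRep) (ContinuousMonoidHom.id (imGS P U))
      (levelMapHomO S P θ U (oMuScalar S (p ^ k) 1) (oMuScalar_muTwistO S θ k 1)) rfl
      (fun w ↦ by
        change coeffMapO S P θ (oMuScalar S (p ^ k) 1) (oMuScalar_muTwistO S θ k 1) w = w
        exact Subtype.ext (oMuScalar_one S (p ^ k) (w : OMuCarrier K S (p ^ k)))) i
  rw [levelScalarO_apply, h]
  rfl

/-- **The `𝒪`-action on `H^i(G_S(F), 𝒪 ⊗ μ_{p^k} ⊗ θ)` as a ring homomorphism `𝒪 → End`** (`c ↦ H^i(c ⊗ id)`).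
[cite: JohnsonLeungKings2011, §4.1 Def. 4.1 (Λ_𝒪 = Λ ⊗̂ 𝒪_p, arXiv p0012:L59–60) and §4.2 (p0012:L109–112)] -/
def levelScalarRingHomO (U : Subgroup (absoluteGaloisGroup K)) (k i : ℕ) :
    padicCoeffIntegers S →+* AddMonoid.End (levelCohO S P θ U k i) where
  toFun c := levelScalarO S P θ U k i c
  map_one' := AddMonoidHom.ext fun x ↦ levelScalarO_one S P θ U k i x
  map_mul' c c' := AddMonoidHom.ext fun x ↦ levelScalarO_mul S P θ U k i c c' x
  map_zero' := by
    have h := levelScalarO_add S P θ U k i 0 0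
    rw [add_zero] at h
    exact left_eq_add.mp h
  map_add' c c' := levelScalarO_add S P θ U k i c c'

/-- **The `𝒪`-module structure of the level group `H^i(G_S(F), 𝒪 ⊗ μ_{p^k} ⊗ θ)`** (through `levelScalarRingHomO`;
activate with `letI`). [cite: JohnsonLeungKings2011, §4.1 Def. 4.1 (arXiv p0012:L59–60) and §4.2 (p0012:L109–112)] -/
@[reducible] def levelModuleO (U : Subgroup (absoluteGaloisGroup K)) (k i : ℕ) :
    Module (padicCoeffIntegers S) (levelCohO S P θ U k i) :=
  Module.compHom (levelCohO S P θ U k i) (levelScalarRingHomO S P θ U k i)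

omit [NumberField K] in
/-- The `𝒪`-action is `c • x = H^i(c ⊗ id) x`. [cite: JohnsonLeungKings2011, §4.2 (arXiv p0012:L109–112)] -/
theorem levelModuleO_smul (U : Subgroup (absoluteGaloisGroup K)) (k i : ℕ) (c : padicCoeffIntegers S)
    (x : levelCohO S P θ U k i) :
    (letI := levelModuleO S P θ U k i; c • x) = levelScalarO S P θ U k i c x := rfl

/-! ## §4 The coefficient maps commute with the conjugation operators -/

omit [NumberField K] in
/-- **Coefficient functoriality commutes with conjugation**: for a `Γ_K`-equivariant coefficient map `f`,
`H^i(f) (γ · y) = γ · H^i(f) y` (the tree's `cohomologyMap_conjMap` with `λ' = λ`).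
[cite: SerreLocalFields1979, VII §5] [cite: JohnsonLeungKings2011, §4.2 (arXiv p0012:L109–112)] -/
theorem levelMapHomO_levelConjO (U : Subgroup (absoluteGaloisGroup K)) [U.Normal] {k k' : ℕ} (i : ℕ)
    (f : OMuCarrier K S (p ^ k) →+ OMuCarrier K S (p ^ k'))
    (hf : ∀ (σ : absoluteGaloisGroup K) (x : OMuCarrier K S (p ^ k)), f (muTwistO S θ k σ x) = muTwistO S θ k' σ (f x))
    (γ : absoluteGaloisGroup K) (y : levelCohO S P θ U k i) :
    (ContinuousCohomology.map (ContinuousMonoidHom.id _) (levelMapHomO S P θ U f hf) i).hom (levelConjO S P θ U k i γ y) =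
      levelConjO S P θ U k' i γ ((ContinuousCohomology.map (ContinuousMonoidHom.id _) (levelMapHomO S P θ U f hf) i).hom y) := by
  haveI := normal_imGS P U
  have hequiv : ∀ (g : GaloisGroupUnramifiedOutside K P) (v : (levelRepO S P θ U k).toTopRep),
      (levelMapHomO S P θ U f hf).hom ((coeffGSO S P θ k).toTopRep.ρ g v) =
        (coeffGSO S P θ k').toTopRep.ρ g ((levelMapHomO S P θ U f hf).hom v) := fun g v ↦ by
    obtain ⟨σ, rfl⟩ := QuotientGroup.mk_surjective g
    exact Subtype.ext (hf σ (v : OMuCarrier K S (p ^ k)))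
  exact cohomologyMap_conjMap (X := (coeffGSO S P θ k).toTopRep) (N := imGS P U) (X' := (coeffGSO S P θ k').toTopRep)
    (levelMapHomO S P θ U f hf) (levelMapHomO S P θ U f hf) (toUnramifiedQuot K P γ) (fun v ↦
      ((congrArg ((coeffGSO S P θ k').toTopRep.ρ (toUnramifiedQuot K P γ)⁻¹) (hequiv (toUnramifiedQuot K P γ) v)).trans
        (ρ_inv_apply_ρ_apply (coeffGSO S P θ k').toTopRep _ _)).symm) i y

omit [NumberField K] in
/-- **The reduction commutes with conjugation.** [cite: Kato2004Asterisque, §8.2 (p. 180)] [cite: SerreLocalFields1979, VII §5] -/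
theorem levelRedO_levelConjO (U : Subgroup (absoluteGaloisGroup K)) [U.Normal] (k i : ℕ) (γ : absoluteGaloisGroup K)
    (y : levelCohO S P θ U (k + 1) i) :
    levelRedO S P θ U k i (levelConjO S P θ U (k + 1) i γ y) = levelConjO S P θ U k i γ (levelRedO S P θ U k i y) :=
  levelMapHomO_levelConjO S P θ U i (oMuRed S k) (oMuRed_muTwistO S θ k) γ y

omit [NumberField K] in
/-- **The coefficient multiplication commutes with conjugation** (so `conj_γ` is `𝒪`-linear).
[cite: JohnsonLeungKings2011, §4.2 (arXiv p0012:L109–112)] -/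
theorem levelScalarO_levelConjO (U : Subgroup (absoluteGaloisGroup K)) [U.Normal] (k i : ℕ) (c : padicCoeffIntegers S)
    (γ : absoluteGaloisGroup K) (y : levelCohO S P θ U k i) :
    levelScalarO S P θ U k i c (levelConjO S P θ U k i γ y) = levelConjO S P θ U k i γ (levelScalarO S P θ U k i c y) :=
  levelMapHomO_levelConjO S P θ U i (oMuScalar S (p ^ k) c) (oMuScalar_muTwistO S θ k c) γ y

omit [NumberField K] in
/-- `(c ⊗ id) ∘ (id ⊗ pow)` is `Γ_K`-equivariant. [folklore] -/
private theorem scalar_comp_red_muTwistO (k : ℕ) (c : padicCoeffIntegers S) (σ : absoluteGaloisGroup K)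
    (x : OMuCarrier K S (p ^ (k + 1))) :
    ((oMuScalar S (p ^ k) c).comp (oMuRed S k)) (muTwistO S θ (k + 1) σ x) =
      muTwistO S θ k σ (((oMuScalar S (p ^ k) c).comp (oMuRed S k)) x) := by
  rw [AddMonoidHom.comp_apply, oMuRed_muTwistO, oMuScalar_muTwistO]; rfl

omit [NumberField K] in
/-- **The reduction is `𝒪`-linear**: `H^i(id ⊗ (ζ ↦ ζ^p)) ∘ H^i(c ⊗ id) = H^i(c ⊗ id) ∘ H^i(id ⊗ (ζ ↦ ζ^p))`
(both equal `H^i(c ⊗ (ζ ↦ ζ^p))`, by pointwise functoriality `map_comp_apply_of`).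
[cite: Kato2004Asterisque, §8.2 (p. 180)] [cite: JohnsonLeungKings2011, §4.1 Def. 4.1 (arXiv p0012:L59–60)] -/
theorem levelRedO_levelScalarO (U : Subgroup (absoluteGaloisGroup K)) (k i : ℕ) (c : padicCoeffIntegers S)
    (y : levelCohO S P θ U (k + 1) i) :
    levelRedO S P θ U k i (levelScalarO S P θ U (k + 1) i c y) = levelScalarO S P θ U k i c (levelRedO S P θ U k i y) := by
  have hcomm : ((oMuRed S k).comp (oMuScalar S (p ^ (k + 1)) c) : OMuCarrier K S (p ^ (k + 1)) →+ OMuCarrier K S (p ^ k)) =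
      (oMuScalar S (p ^ k) c).comp (oMuRed S k) := by
    apply AddMonoidHom.ext
    intro x
    induction x using OMuCarrier.induction_on with
    | zero => simp
    | tmul a v => rfl
    | add x y hx hy => rw [map_add, map_add, hx, hy]
  rw [levelRedO_apply, levelScalarO_apply, levelRedO_apply, levelScalarO_apply]
  have h1 := map_comp_apply_of (ContinuousMonoidHom.id (imGS P U)) (ContinuousMonoidHom.id _) (ContinuousMonoidHom.id _)
    (fun _ ↦ rfl) (levelMapHomO S P θ U (oMuScalar S (p ^ (k + 1)) c) (oMuScalar_muTwistO S θ (k + 1) c))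
    (levelMapHomO S P θ U (oMuRed S k) (oMuRed_muTwistO S θ k))
    (levelMapHomO S P θ U ((oMuScalar S (p ^ k) c).comp (oMuRed S k)) (scalar_comp_red_muTwistO S θ k c))
    (fun w ↦ Subtype.ext (DFunLike.congr_fun hcomm (w : OMuCarrier K S (p ^ (k + 1)))).symm) i y
  have h2 := map_comp_apply_of (ContinuousMonoidHom.id (imGS P U)) (ContinuousMonoidHom.id _) (ContinuousMonoidHom.id _)
    (fun _ ↦ rfl) (levelMapHomO S P θ U (oMuRed S k) (oMuRed_muTwistO S θ k))
    (levelMapHomO S P θ U (oMuScalar S (p ^ k) c) (oMuScalar_muTwistO S θ k c))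
    (levelMapHomO S P θ U ((oMuScalar S (p ^ k) c).comp (oMuRed S k)) (scalar_comp_red_muTwistO S θ k c))
    (fun _ ↦ rfl) i y
  exact h1.symm.trans h2

end Level

/-! ## §5 The layers of the `ℤ_p²`-tower: unipotence and commutation of the two conjugation operators,
`IsLocNil₂`, equivariance of the reduction, `𝒪`-linearity data -/

section LayerOps

variable {K : Type} [Field K] [NumberField K] {p : ℕ} [Fact p.Prime] (S : Set (PadicAlgCl p))
  (κ₁ κ₂ : ZpExtension K p) (γ₁ γ₂ : absoluteGaloisGroup K)
  (θ : absoluteGaloisGroup K →ₜ* (padicCoeffIntegers S)ˣ) (𝔣 : Ideal (𝓞 K))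

/-- The conjugation operator of `γ` on the layer group `(n, k)`, in `AddMonoid.End`.
[cite: JohnsonLeungKings2011, §4.2 (arXiv p0012:L109–112)] -/
abbrev layerConjEndO (n k i : ℕ) (γ : absoluteGaloisGroup K) : AddMonoid.End (layerCohO S κ₁ κ₂ θ 𝔣 n k i) :=
  conjEndO S (suppPF p 𝔣) θ (pairLayerSubgroup κ₁ κ₂ n) k i γ

/-- **`(γ ·)^{pⁿ} = id` on the layer `(n, k)`**, `i ≤ 2` (`γ^{pⁿ} ∈ Gal(K̄/K̃_n)` acts as an inner automorphism).
[cite: Lang1990, Ch. 5 §1] [cite: SerreLocalFields1979, VII §5 Prop. 3] -/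
theorem layerConjEndO_pow_apply_eq_self (n k : ℕ) {i : ℕ} (hi : i ≤ 2) (γ : absoluteGaloisGroup K)
    (c : layerCohO S κ₁ κ₂ θ 𝔣 n k i) : (layerConjEndO S κ₁ κ₂ θ 𝔣 n k i γ ^ p ^ n) c = c := by
  rw [layerConjEndO, conjEndO_pow_apply]
  exact levelConjO_eq_self_of_mem S (suppPF p 𝔣) θ (pow_mem_pairLayerSubgroup κ₁ κ₂ γ n)
    (isOpen_pairLayerSubgroup κ₁ κ₂ n) k hi c

/-- **The two conjugation operators commute on the layers**, `i ≤ 2` (their commutator is conjugation by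
`[γ₁, γ₂] ∈ Gal(K̄/K̃_n)`). [cite: JohnsonLeungKings2011, §4.1–4.2 (arXiv p0012:L7–14, L109–112)] -/
theorem commute_layerConjEndO (n k : ℕ) {i : ℕ} (hi : i ≤ 2) :
    Commute (layerConjEndO S κ₁ κ₂ θ 𝔣 n k i γ₁) (layerConjEndO S κ₁ κ₂ θ 𝔣 n k i γ₂) := by
  ext c
  change levelConjO S (suppPF p 𝔣) θ _ k i γ₁ (levelConjO S (suppPF p 𝔣) θ _ k i γ₂ c) =
    levelConjO S (suppPF p 𝔣) θ _ k i γ₂ (levelConjO S (suppPF p 𝔣) θ _ k i γ₁ c)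
  rw [levelConjO_levelConjO, levelConjO_levelConjO,
    show γ₁ * γ₂ = (γ₁ * γ₂ * γ₁⁻¹ * γ₂⁻¹) * (γ₂ * γ₁) by group, ← levelConjO_levelConjO,
    levelConjO_eq_self_of_mem S (suppPF p 𝔣) θ (commutator_mem_pairLayerSubgroup κ₁ κ₂ γ₁ γ₂ n)
      (isOpen_pairLayerSubgroup κ₁ κ₂ n) k hi]

/-- **`(conj_{γ₁} − 1, conj_{γ₂} − 1)` is `IsLocNil₂` on every layer group `H^i(G_S(K̃_n), 𝒪 ⊗ μ_{p^k} ⊗ θ)`, `i ≤ 2`**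
(uniform `p^k`-torsion, unipotence of echelon `pⁿ`, commutation): both operators are locally nilpotent and commute.
[cite: JohnsonLeungKings2011, §4.2 (arXiv p0012:L109–112)] [cite: Lang1990, Ch. 5 §1] -/
theorem isLocNil₂_layerConjEndO (n k : ℕ) {i : ℕ} (hi : i ≤ 2) :
    IsLocNil₂ p (layerConjEndO S κ₁ κ₂ θ 𝔣 n k i γ₁ - 1) (layerConjEndO S κ₁ κ₂ θ 𝔣 n k i γ₂ - 1) := by
  have h := isLocNil₂_twistEnd_sub_one (p := p) (e := k) (m₁ := n) (m₂ := n) (n₁ := 1) (n₂ := 1)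
    (layerConjEndO S κ₁ κ₂ θ 𝔣 n k i γ₁) (layerConjEndO S κ₁ κ₂ θ 𝔣 n k i γ₂)
    (commute_layerConjEndO S κ₁ κ₂ γ₁ γ₂ θ 𝔣 n k hi)
    (fun a ↦ levelCohO_torsion S (suppPF p 𝔣) θ (isOpen_pairLayerSubgroup κ₁ κ₂ n) k i a)
    (fun a ↦ layerConjEndO_pow_apply_eq_self S κ₁ κ₂ θ 𝔣 n k hi γ₁ a)
    (fun a ↦ layerConjEndO_pow_apply_eq_self S κ₁ κ₂ θ 𝔣 n k hi γ₂ a)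
    (by rw [Nat.cast_one, sub_self]; exact dvd_zero _) (by rw [Nat.cast_one, sub_self]; exact dvd_zero _)
  rwa [twistEnd_one, twistEnd_one] at h

/-- **The `𝒪`-LINEAR operator `conj_γ − 1` on the layer `(n, k)`** (for the `𝒪`-structure `levelModuleO`:
`conj_γ` commutes with every `H^i(c ⊗ id)`). [cite: JohnsonLeungKings2011, §4.2 (arXiv p0012:L109–112)] -/
def layerPsiO (n k i : ℕ) (γ : absoluteGaloisGroup K) :
    letI := levelModuleO S (suppPF p 𝔣) θ (pairLayerSubgroup κ₁ κ₂ n) k i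
    Module.End (padicCoeffIntegers S) (layerCohO S κ₁ κ₂ θ 𝔣 n k i) := by
  letI := levelModuleO S (suppPF p 𝔣) θ (pairLayerSubgroup κ₁ κ₂ n) k i
  exact
    { toFun := fun c ↦ layerConjO S κ₁ κ₂ θ 𝔣 n k i γ c - c
      map_add' := fun x y ↦ by rw [map_add]; abel
      map_smul' := fun c x ↦ by
        change levelConjO S (suppPF p 𝔣) θ _ k i γ (levelScalarO S (suppPF p 𝔣) θ _ k i c x) - levelScalarO S _ θ _ k i c x =
          levelScalarO S (suppPF p 𝔣) θ _ k i c (levelConjO S (suppPF p 𝔣) θ _ k i γ x - x)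
        rw [map_sub, levelScalarO_levelConjO] }

omit [NumberField K] in
/-- Unfolding `layerPsiO`: `ψ_γ c = γ·c − c`. [cite: JohnsonLeungKings2011, §4.2 (arXiv p0012:L109–112)] -/
theorem layerPsiO_apply (n k i : ℕ) (γ : absoluteGaloisGroup K) (c : layerCohO S κ₁ κ₂ θ 𝔣 n k i) :
    (letI := levelModuleO S (suppPF p 𝔣) θ (pairLayerSubgroup κ₁ κ₂ n) k i
     layerPsiO S κ₁ κ₂ θ 𝔣 n k i γ c) = layerConjO S κ₁ κ₂ θ 𝔣 n k i γ c - c := rfl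

omit [NumberField K] in
/-- Powers of `ψ_γ` agree with powers of `conj_γ − 1` in `AddMonoid.End`. [folklore] -/
private theorem layerPsiO_pow_apply (n k i : ℕ) (γ : absoluteGaloisGroup K) (m : ℕ) (c : layerCohO S κ₁ κ₂ θ 𝔣 n k i) :
    (letI := levelModuleO S (suppPF p 𝔣) θ (pairLayerSubgroup κ₁ κ₂ n) k i
     (layerPsiO S κ₁ κ₂ θ 𝔣 n k i γ ^ m) c) = ((layerConjEndO S κ₁ κ₂ θ 𝔣 n k i γ - 1) ^ m) c := by
  letI := levelModuleO S (suppPF p 𝔣) θ (pairLayerSubgroup κ₁ κ₂ n) k i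
  induction m generalizing c with
  | zero => rfl
  | succ m ih =>
    rw [pow_succ, pow_succ, Module.End.mul_apply, AddMonoid.End.coe_mul, Function.comp_apply, layerPsiO_apply, ih]
    rfl

/-- **`ψ_{γ₁}`, `ψ_{γ₂}` commute and are locally nilpotent on every layer group**, `i ≤ 2` — the hypotheses of
`LocallyNilpotent.exists_module_powerSeries₂` (so the layer is a `Λ_𝒪 = 𝒪⟦T₂⟧⟦T₁⟧`-module with `T_i ↦ ψ_{γ_i}`).
[cite: JohnsonLeungKings2011, §4.2 (arXiv p0012:L109–112)] [cite: Lang1990, Ch. 5 §1] -/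
theorem layerPsiO_comm_and_locallyNilpotent (n k : ℕ) {i : ℕ} (hi : i ≤ 2) :
    letI := levelModuleO S (suppPF p 𝔣) θ (pairLayerSubgroup κ₁ κ₂ n) k i
    layerPsiO S κ₁ κ₂ θ 𝔣 n k i γ₁ * layerPsiO S κ₁ κ₂ θ 𝔣 n k i γ₂ =
        layerPsiO S κ₁ κ₂ θ 𝔣 n k i γ₂ * layerPsiO S κ₁ κ₂ θ 𝔣 n k i γ₁ ∧
      (∀ c, ∃ m : ℕ, (layerPsiO S κ₁ κ₂ θ 𝔣 n k i γ₁ ^ m) c = 0) ∧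
        ∀ c, ∃ m : ℕ, (layerPsiO S κ₁ κ₂ θ 𝔣 n k i γ₂ ^ m) c = 0 := by
  letI := levelModuleO S (suppPF p 𝔣) θ (pairLayerSubgroup κ₁ κ₂ n) k i
  have h := isLocNil₂_layerConjEndO S κ₁ κ₂ γ₁ γ₂ θ 𝔣 n k hi
  refine ⟨?_, fun c ↦ ?_, fun c ↦ ?_⟩
  · apply LinearMap.ext
    intro c
    exact congrArg (fun φ : AddMonoid.End (layerCohO S κ₁ κ₂ θ 𝔣 n k i) ↦ φ c) h.comm.eq
  · obtain ⟨m, hm⟩ := h.nil₁ c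
    exact ⟨m, by rw [layerPsiO_pow_apply, hm]⟩
  · obtain ⟨m, hm⟩ := h.nil₂ c
    exact ⟨m, by rw [layerPsiO_pow_apply, hm]⟩

omit [NumberField K] in
/-- **The reductions intertwine the conjugation operators on the layers.** [cite: Kato2004Asterisque, §8.2 (p. 180)] -/
theorem layerRedO_layerConjO (n k i : ℕ) (γ : absoluteGaloisGroup K) (y : layerCohO S κ₁ κ₂ θ 𝔣 n (k + 1) i) :
    layerRedO S κ₁ κ₂ θ 𝔣 n k i (layerConjO S κ₁ κ₂ θ 𝔣 n (k + 1) i γ y) =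
      layerConjO S κ₁ κ₂ θ 𝔣 n k i γ (layerRedO S κ₁ κ₂ θ 𝔣 n k i y) :=
  levelRedO_levelConjO S (suppPF p 𝔣) θ (pairLayerSubgroup κ₁ κ₂ n) k i γ y

omit [NumberField K] in
/-- **The reductions are `𝒪`-linear on the layers.** [cite: Kato2004Asterisque, §8.2 (p. 180)] [cite: JohnsonLeungKings2011, §4.1 Def. 4.1 (arXiv p0012:L59–60)] -/
theorem layerRedO_layerScalarO (n k i : ℕ) (c : padicCoeffIntegers S) (y : layerCohO S κ₁ κ₂ θ 𝔣 n (k + 1) i) :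
    layerRedO S κ₁ κ₂ θ 𝔣 n k i (layerScalarO S κ₁ κ₂ θ 𝔣 n (k + 1) i c y) =
      layerScalarO S κ₁ κ₂ θ 𝔣 n k i c (layerRedO S κ₁ κ₂ θ 𝔣 n k i y) :=
  levelRedO_levelScalarO S (suppPF p 𝔣) θ (pairLayerSubgroup κ₁ κ₂ n) k i c y

end LayerOps

end Literature.NumberTheory.ComplexMultiplication.EllipticUnits.JohnsonLeungKings2011

end
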